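import Summits.ValiantsHypothesis.ValiantsHypothesis.Theorems.DefinabilityGapSquarePermanent
import HarnessLib

/-!
# DefinabilityGap — SQUARE RIGIDITY, stage H4c: the unconditional quadratic count for voids

Route `route-ValiantsHypothesis-DefinabilityGap` (DRAFT), read-once leaf F4 / W10 (aside `KIPlantedHittingRO`,
stmt-ValiantsHypothesis-23704), leaf `ZperHits₂(m)` (= hypothesis `hZ` of
`DefinabilityGapZperTransfer.chainVal_eq_zero_of_bind₁_kiPer`); census cell W10.rung_ladder.next ‖ v38
«branch (C) (avoid T = ∅): max-matching top form (H4)» (decomp-valiant bus, CALL O-L5-MM; file H4c of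
H4a / H4b / H4c; continues H3 `DefinabilityGapBlockRigidity`).

**THIS FILE — THE UNCONDITIONAL COUNT.** H3 proved: in a VOID (a width-2 chain of univariate-image links
with `c`-local labels whose value is a NONZERO multiple of `per_m`), every cell set `T` carrying the labels of
all non-unit links satisfies `m² ≤ 2·|T| + c·m` PROVIDED some permutation avoids `T` — otherwise only a
rectangle of `T` was produced (branch (C)). Here branch (C) is removed:
* `chainVal_eq_zero_of_topForm_factor` — H3's engine with a prime factor `Q` of the TOP FORM of `Φ_T(per_m)`
  as input (E2 `chainVal_eq_zero_of_prime_of_eq_mul` under E3's injective specialisation `Φ_T`);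
* `chainVal_eq_zero_of_bigSquareBlock` — branch (A□): for a maximum `T`-free pair `(σ₀, D)` (H4a), a block of
  the auxiliary pattern `T♯` through a square row with more than `c` rows kills the void: its block
  permanent is prime (H2), owns no nonzero `c`-local top form (H2 KEY), and divides the square permanent
  `Q□` (H4b `blockPer_dvd_sqPer`), which is — up to a nonzero constant — the top form of `Φ_{T̂}(per_m)` for
  the PADDED pattern `T̂ ⊇ T` (H4b `topForm_spec_pad`);
* `sq_le_of_void` — HEADLINE: otherwise all square blocks have at most `c` rows and H4a's count
  `sq_le_of_maxFree` gives `m² ≤ 2·|T| + c·|D| ≤ 2·|T| + c·m`. NO hypothesis on `T` remains;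
* `sq_le_nuCount` — the δ-form `m² ≤ 2c·δ + c·m` (`δ` = number of non-unit links), and the two leaf-shaped
  `c = 2` instances `zperHits_of_card_lt` / `zperHits_of_few_nonunit` WITHOUT H3's `avoid ≠ ∅` hypotheses.

HONEST PLACEMENT. KNOWN ingredients (König / term rank, the Dulmage–Mendelsohn–Brualdi normal form in strip
form, block permanents [cite: BrualdiRyser1991, Thm. 1.2.1, Thm. 4.2.1, Thm. 4.2.7]; E2/E3/H1–H3 of this
lineage) in a new combination on this leaf; KERNEL-NEW; closes NO item; 0 S-currency; rung 0: the leaf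
`ZperHits₂(m)` (all chains), 23704's tag, `KIPlantedHitting` and VP ≠ VNP are UNTOUCHED. CEILING of the
method: `m² ≤ 2·|T| + c·m` (quadratic `δ`); nothing super-quadratic is claimed. No facts, no Prop-valued
definitions, no data definitions, no placeholders.
-/

set_option linter.dupNamespace false

open MvPolynomial Finset
open Literature.Computability.AlgebraicComplexity
open Summit.ValiantsHypothesis.ValiantsHypothesis.Theorems.DefinabilityGapUnitRigidityForms
open Summit.ValiantsHypothesis.ValiantsHypothesis.Theorems.DefinabilityGapZperTransfer
open Summit.ValiantsHypothesis.ValiantsHypothesis.Theorems.DefinabilityGapZeroPatternPermanent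
open Summit.ValiantsHypothesis.ValiantsHypothesis.Theorems.DefinabilityGapPrimeRigidity
open Summit.ValiantsHypothesis.ValiantsHypothesis.Theorems.DefinabilityGapLabelSupport
open Summit.ValiantsHypothesis.ValiantsHypothesis.Theorems.DefinabilityGapAdmissibleBlocks
open Summit.ValiantsHypothesis.ValiantsHypothesis.Theorems.DefinabilityGapBlockExclusion
open Summit.ValiantsHypothesis.ValiantsHypothesis.Theorems.DefinabilityGapBlockPermanent
open Summit.ValiantsHypothesis.ValiantsHypothesis.Theorems.DefinabilityGapBlockRigidity
open Summit.ValiantsHypothesis.ValiantsHypothesis.Theorems.DefinabilityGapMatchingSquare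
open Summit.ValiantsHypothesis.ValiantsHypothesis.Theorems.DefinabilityGapSquarePermanent

namespace Summit.ValiantsHypothesis.ValiantsHypothesis.Theorems.DefinabilityGapSquareRigidity

noncomputable section

variable {m : ℕ}

section Rigidity

variable {K : Type*} [Field K] {K' : Type*} [Field K'] (ι : MvPolynomial (Fin m × Fin m) K →+* K') {c : ℕ}

/-- S-RIGIDITY WITH A PRIME FACTOR OF THE TOP FORM: H3's engine `chainVal_eq_zero_of_support_of_factor` with
`Q ∣ topForm Φ_T(per_m)` as the input instead of `Q ∣ Q_T` (E2 `chainVal_eq_zero_of_prime_of_eq_mul` after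
E3's injective change of constants `Φ_T`). [this file] -/
theorem chainVal_eq_zero_of_topForm_factor (hι : Function.Injective ι) {T : Finset (Fin m × Fin m)}
    {Q : MvPolynomial (Fin m × Fin m) K'} (hQ : Prime Q)
    (hkey : ∀ f ∈ locSpan K' (Fin m × Fin m) c, f ≠ 0 → ¬ Q ∣ topForm f)
    (hP : Q ∣ topForm (spec ι T (perPoly (Fin m) K)))
    (l : List (Matrix (Fin 2) (Fin 2) (Polynomial K) × MvPolynomial (Fin m × Fin m) K))
    (hloc : ∀ e ∈ l, ∃ S : Finset (Fin m × Fin m), S.card ≤ c ∧ e.2.vars ⊆ S)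
    (hsup : ∀ e ∈ l, IsUnit e.1.det ∨ e.2.vars ⊆ T) (u v : Fin 2 → K)
    (H : MvPolynomial (Fin m × Fin m) K) (h : chainVal (l.map ulink) u v = perPoly (Fin m) K * H) :
    chainVal (l.map ulink) u v = 0 := by
  have hspec : spec ι T (chainVal (l.map ulink) u v) = chainVal ((l.map ulink).map fun N => N.map (spec ι T))
      (fun i => (ι.comp C) (u i)) (fun k => (ι.comp C) (v k)) :=
    map_chainVal (spec ι T) (ι.comp C) (spec_C ι T) _ u v
  have key : chainVal ((l.map ulink).map fun N => N.map (spec ι T)) (fun i => (ι.comp C) (u i))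
      (fun k => (ι.comp C) (v k)) = 0 := by
    refine chainVal_eq_zero_of_prime_of_eq_mul hQ hkey hP _ ?_ _ _ (spec ι T H) (by rw [← hspec, h, map_mul])
    intro N hN
    obtain ⟨N', hN', rfl⟩ := List.mem_map.1 hN
    obtain ⟨e, he, rfl⟩ := List.mem_map.1 hN'
    exact spec_ulink_mem ι T (hloc e he) (hsup e he)
  exact spec_injective ι hι T (by rw [hspec, key, map_zero])

/-- **SQUARE RIGIDITY (branch A□).** `K` any field; `(σ₀, D)` `T`-free on `D`; a block of `T♯` through a square
row `σ₀ i`, `i ∈ D`, with more than `c` rows; a width-2 chain of univariate-image links with `c`-local labels,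
every link a unit link or `T`-labelled: `per_m ∣ uᵀ L v ⇒ uᵀ L v = 0` (the prime is the block permanent of
`T♯` over `K(Y)`: H2 `blockPer_prime` / `not_blockPer_dvd_topForm`, H4b `blockPer_dvd_sqPer` /
`topForm_spec_pad`, applied to the padded pattern `T̂ ⊇ T`). [this file] -/
theorem chainVal_eq_zero_of_bigSquareBlock {T : Finset (Fin m × Fin m)} {σ₀ : Equiv.Perm (Fin m)}
    {D : Finset (Fin m)} (hfree : ∀ i ∈ D, (σ₀ i, i) ∉ T) {i : Fin m} (hi : i ∈ D)
    (hc : c < (rowBlock (sharp T σ₀ D) (σ₀ i)).card)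
    (l : List (Matrix (Fin 2) (Fin 2) (Polynomial K) × MvPolynomial (Fin m × Fin m) K))
    (hloc : ∀ e ∈ l, ∃ S : Finset (Fin m × Fin m), S.card ≤ c ∧ e.2.vars ⊆ S)
    (hsup : ∀ e ∈ l, IsUnit e.1.det ∨ e.2.vars ⊆ T) (u v : Fin 2 → K)
    (H : MvPolynomial (Fin m × Fin m) K) (h : chainVal (l.map ulink) u v = perPoly (Fin m) K * H) :
    chainVal (l.map ulink) u v = 0 := by
  have hσ₀ := self_mem_avoid_sharp hfree
  refine chainVal_eq_zero_of_topForm_factor (algebraMap _ (FractionRing (MvPolynomial (Fin m × Fin m) K)))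
    (IsFractionRing.injective _ _) (T := pad T σ₀ D) (blockPer_prime hσ₀ (σ₀ i))
    (fun f hf hf0 => not_blockPer_dvd_topForm hσ₀ hc hf hf0) ?_ l hloc
    (fun e he => (hsup e he).imp_right fun hs => hs.trans subset_pad) u v H h
  rw [topForm_spec_pad _ (IsFractionRing.injective _ _) hfree]
  exact dvd_mul_of_dvd_left (blockPer_dvd_sqPer hfree hi) _

/-- **VOID PLACEMENT, UNCONDITIONAL (headline).** In a VOID — a non-zero chain value divisible by `per_m`, all
labels `c`-local — every cell set `T` carrying the labels of all non-unit links satisfies `m² ≤ 2·|T| + c·m`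
(no `avoid T ≠ ∅` hypothesis, no rectangle escape): take a maximum `T`-free pair `(σ₀, D)` (H4a
`exists_max_free`); a square block of `T♯` with more than `c` rows is excluded by `chainVal_eq_zero_of_
bigSquareBlock`, so H4a `sq_le_of_maxFree` applies. [this file] -/
theorem sq_le_of_void (T : Finset (Fin m × Fin m))
    (l : List (Matrix (Fin 2) (Fin 2) (Polynomial K) × MvPolynomial (Fin m × Fin m) K))
    (hloc : ∀ e ∈ l, ∃ S : Finset (Fin m × Fin m), S.card ≤ c ∧ e.2.vars ⊆ S)
    (hsup : ∀ e ∈ l, IsUnit e.1.det ∨ e.2.vars ⊆ T) (u v : Fin 2 → K)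
    (H : MvPolynomial (Fin m × Fin m) K) (h : chainVal (l.map ulink) u v = perPoly (Fin m) K * H)
    (hne : chainVal (l.map ulink) u v ≠ 0) : m * m ≤ 2 * T.card + c * m := by
  obtain ⟨σ₀, hmax⟩ := exists_max_free T
  have hfree : ∀ i ∈ free T σ₀, (σ₀ i, i) ∉ T := fun _ hi => mem_free.1 hi
  by_cases hall : ∀ i ∈ free T σ₀, (rowBlock (sharp T σ₀ (free T σ₀)) (σ₀ i)).card ≤ c
  · have h1 := sq_le_of_maxFree hfree hmax hall
    have h2 : c * (free T σ₀).card ≤ c * m :=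
      Nat.mul_le_mul_left c (((free T σ₀).card_le_univ).trans (Fintype.card_fin m).le)
    omega
  · push Not at hall
    obtain ⟨i, hi, hc⟩ := hall
    exact (hne (chainVal_eq_zero_of_bigSquareBlock hfree hi hc l hloc hsup u v H h)).elim

/-- **QUADRATIC δ, UNCONDITIONAL.** In a void with `c`-local labels the number `δ` of non-unit links
satisfies `m² ≤ 2c·δ + c·m`, i.e. `δ ≥ m(m−c)/(2c)` — wherever the non-unit links sit (`sq_le_of_void` for
the non-unit support, H3 `card_nuSupport_le`). [this file] -/
theorem sq_le_nuCount
    (l : List (Matrix (Fin 2) (Fin 2) (Polynomial K) × MvPolynomial (Fin m × Fin m) K))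
    (hloc : ∀ e ∈ l, ∃ S : Finset (Fin m × Fin m), S.card ≤ c ∧ e.2.vars ⊆ S) (u v : Fin 2 → K)
    (H : MvPolynomial (Fin m × Fin m) K) (h : chainVal (l.map ulink) u v = perPoly (Fin m) K * H)
    (hne : chainVal (l.map ulink) u v ≠ 0) : m * m ≤ 2 * c * nuCount l + c * m := by
  classical
  have hsup : ∀ e ∈ l, IsUnit e.1.det ∨ e.2.vars ⊆ nuSupport l := fun e he =>
    or_iff_not_imp_left.2 fun hu x hx => by
      simp only [nuSupport, mem_filter, mem_univ, true_and]
      exact ⟨e, he, hu, hx⟩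
  have hsq := sq_le_of_void (nuSupport l) l hloc hsup u v H h hne
  have hc := card_nuSupport_le l hloc
  refine hsq.trans ?_
  nlinarith [hc]

end Rigidity

/-- LEAF-SHAPED INSTANCE (`c = 2`) WITHOUT the `avoid T ≠ ∅` hypothesis of H3 `zperHits_of_nonunit_support`:
the leaf's hypothesis `hZ` for chains whose non-unit links are labelled inside a cell set `T` with
`2·|T| + 2m < m²`. [this file] -/
theorem zperHits_of_card_lt (F : Type*) [Field F] (T : Finset (Fin m × Fin m))
    (hT : 2 * T.card + 2 * m < m * m)
    (l : List (Matrix (Fin 2) (Fin 2) (Polynomial F) × MvPolynomial (Fin m × Fin m) F))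
    (hl : ∀ e ∈ l, ∃ S : Finset (Fin m × Fin m), S.card ≤ 2 ∧ e.2.vars ⊆ S)
    (hone : ∀ e ∈ l, IsUnit e.1.det ∨ e.2.vars ⊆ T) (u v : Fin 2 → F)
    (H : MvPolynomial (Fin m × Fin m) F) (h : chainVal (l.map ulink) u v = perPoly (Fin m) F * H) :
    chainVal (l.map ulink) u v = 0 := by
  by_contra hne
  have hsq := sq_le_of_void (c := 2) T l hl hone u v H h hne
  omega

/-- LEAF-SHAPED INSTANCE (`c = 2`, δ-form) WITHOUT the `avoid ≠ ∅` hypothesis of H3 `zperHits_of_nuCount_lt`: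
a chain with `2`-local labels and fewer than `m(m−2)/4` non-unit links satisfies `hZ`. [this file] -/
theorem zperHits_of_few_nonunit (F : Type*) [Field F]
    (l : List (Matrix (Fin 2) (Fin 2) (Polynomial F) × MvPolynomial (Fin m × Fin m) F))
    (hl : ∀ e ∈ l, ∃ S : Finset (Fin m × Fin m), S.card ≤ 2 ∧ e.2.vars ⊆ S)
    (hδ : 4 * nuCount l + 2 * m < m * m) (u v : Fin 2 → F)
    (H : MvPolynomial (Fin m × Fin m) F) (h : chainVal (l.map ulink) u v = perPoly (Fin m) F * H) :
    chainVal (l.map ulink) u v = 0 := by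
  by_contra hne
  have hsq := sq_le_nuCount (c := 2) l hl u v H h hne
  omega

end

end Summit.ValiantsHypothesis.ValiantsHypothesis.Theorems.DefinabilityGapSquareRigidity
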